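import Summits.RiemannHypothesis.RiemannHypothesis.Theorems.JensenLogBandArcSaddlePolar
import HarnessLib

/-!
# Sharp location of the model saddle in the bounded-radius regime (BAND crux, far-zone input F4)

RH ladder column JENSEN, rung J-P(P3) «log band», BAND crux `XiDerivBandRealAllRates`
(stmt-RiemannHypothesis-19913) of route «JensenLogBand», line «band-one-window» (u-arc reshape,
lead rh-jensen-prover g7) — FAR-ZONE / regime-(R2) input of HOME/rh-jensen-prover/g7-work/LINE-PLAN.md
§8.2. RH-FREE `Γ`-factor calculus. WHAT THIS IS NOT: nothing here bears on zeros of `ζ` or the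
truth of RH.

The lead's τ-uniform polar localisation (`arcSaddle_polar_bounds`: `(100/71) n/ℓ ≤ ‖u* − c‖ ≤
(20/9) n/ℓ`, `−0.23 ≤ tan φ₀ ≤ 0.32 + 2/ℓ`) costs a factor `(r*/h)^{n+1} = e^{Θ(n)}` in the
far-zone kernel comparison. In the regime where the band radius is BOUNDED (`h = h(n,T) ≤ 20`,
i.e. regime (R2) of the LINE-PLAN, which contains the whole far zone `h < 1 + δ₁ ≤ 3/2`), the
height is astronomically large (`T = 2π e^{ℓ_T}`, `ℓ_T = 2(n+1)/h ≥ (n+1)/10`) and the saddle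
equation `u* − c = n/D(u*)` linearises: `‖D(u*) − ℓ_T/2‖ ≤ 7/5` (`norm_saddleDen_sub_half_ell_le`),
whence

* `norm_arcSaddle_sub_center_sub_radius_le`: **`‖u* − (c + h)‖ ≤ (2 + (16/5) h)/ℓ_T`**, and
* `arcSaddle_sharp_polar`: `h − ε ≤ Re(u* − c)`, `|Im(u* − c)| ≤ ε`, `h − ε ≤ ‖u* − c‖ ≤ h + ε`
  with `ε = (2 + (16/5) h)/ℓ_T` — so `(r*/h)^{n+1} ≤ exp((n+1)ε/h) = exp((ℓ_T/2)·ε) ≤ e^{1 + 8h/5}`,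
  a CONSTANT, and the own window abscissa is `σ* ≥ ½ + x + h − ε`.

(prover-rh-jensen-eng-2-g6-0, 2026-08-27.)
-/

noncomputable section

-- single-problem summit: `Summit.RiemannHypothesis.RiemannHypothesis.…` is the tree convention
set_option linter.dupNamespace false

open Complex Real Set

namespace Summit.RiemannHypothesis.RiemannHypothesis.Theorems.JensenPolynomials.LogBandArc

open Literature.NumberTheory.LFunctions

variable {n : ℕ} {x T : ℝ} {u : ℂ}

/-- In the regime `ℓ_T ≥ 20` the height dominates `ℓ_T²`: `60 ℓ_T ≤ T` (`T = 2π e^{ℓ_T} ≥ π ℓ_T²`).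
RH-FREE. [folklore] -/
theorem sixty_mul_ell_le (hT : 100 ≤ T) (hℓ : 20 ≤ ell T) : 60 * ell T ≤ T := by
  have hT0 : 0 < T := by linarith
  have hexp : Real.exp (ell T) = T / (2 * π) := by
    rw [ell, Real.exp_log (by positivity)]
  have hq := Real.quadratic_le_exp_of_nonneg (show 0 ≤ ell T by linarith)
  rw [hexp] at hq
  -- `ℓ²/2 ≤ T/(2π)` ⇒ `π ℓ² ≤ T` ⇒ `3·20·ℓ ≤ T`
  have hπ3 : 3 < π := Real.pi_gt_three
  have h1 : ell T ^ 2 / 2 ≤ T / (2 * π) := by nlinarith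
  rw [div_le_div_iff₀ (by norm_num) (by positivity)] at h1
  nlinarith

set_option maxHeartbeats 400000 in
/-- **Linearisation of the saddle denominator** in the bounded-radius regime: on the disc
`‖u − (c + h)‖ ≤ (3/5) h` with `h = h(n,T) ≤ 20` (regime `|x| ≤ ½`, `T ≥ 100`, `ℓ_T ≥ 20`,
`½ ≤ h ≤ (7/20) T`), `‖D(u) − ℓ_T/2‖ ≤ 7/5`. Ingredients: Stirling `‖λ′ − ½Log(s/2π)‖ ≤ 6/Im s`,
`½Log(s/2π) − ℓ_T/2 = ½ log(‖s‖/T) + (i/2) arg s` with `‖s‖/T ∈ [0.79, 1.78]`, `arg s ∈ [0, π/2]`,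
`‖1/u‖ ≤ 2/157`, and `(n+1)/‖u+c‖ ≤ 10 ℓ_T/(1.79 T) ≤ 1/10` by `sixty_mul_ell_le`. RH-FREE.
[folklore] -/
theorem norm_saddleDen_sub_half_ell_le (hx : |x| ≤ 1 / 2) (hT : 100 ≤ T) (hℓ : 20 ≤ ell T)
    (hh : 1 / 2 ≤ bandRadius n T) (hhT : bandRadius n T ≤ 7 / 20 * T) (hH : bandRadius n T ≤ 20)
    (hu : ‖u - ((x : ℂ) + (T : ℂ) * I + bandRadius n T)‖ ≤ 3 / 5 * bandRadius n T) :
    ‖saddleDen n ((x : ℂ) + (T : ℂ) * I) u - (ell T / 2 : ℝ)‖ ≤ 7 / 5 := by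
  set h := bandRadius n T with hhdef
  set ℓ := ell T with hℓdef
  set c : ℂ := (x : ℂ) + (T : ℂ) * I with hc
  set s : ℂ := 1 / 2 + u with hs
  obtain ⟨him_lo, him_hi, hre_lo, hre_hi, hns_lo, hns_hi, hnu_lo, hucim, hucre, hnuc⟩ :=
    disc_geometry hx hT hh hhT hu
  rw [← hc] at hucim hucre hnuc
  rw [← hs] at him_lo him_hi hre_lo hre_hi hns_lo hns_hi
  have hT0 : 0 < T := by linarith
  have hℓ0 : 0 < ℓ := by linarith
  have hhℓ : h * ℓ = 2 * ((n : ℝ) + 1) := bandRadius_mul_ell hℓ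
  have hs0 : s ≠ 0 := by
    intro h0; rw [h0, norm_zero] at hns_lo; linarith
  have him0 : 0 < s.im := him_lo.trans_lt' (by linarith)
  -- Stirling error `E = λ′(s) − ½Log(s/2π)`, `‖E‖ ≤ 6/Im s ≤ 2/25`
  have hE : ‖lamPrime s - Complex.log (s / (2 * Real.pi)) / 2‖ ≤ 2 / 25 := by
    have h1 : ‖lamPrime s - Complex.log (s / (2 * Real.pi)) / 2‖ ≤ 6 / s.im := by
      unfold lamPrime
      exact norm_xiGammaLogDeriv_sub_half_log_le_of_re_nonneg (by linarith) (by linarith)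
    refine h1.trans ?_
    rw [div_le_div_iff₀ him0 (by norm_num)]
    linarith
  -- main term `L = ½Log(s/2π)`: `Re L − ℓ/2 = ½(log‖s‖ − log T)`, `Im L ∈ [0, π/4]`
  obtain ⟨hLre, hLim0, hLim1⟩ := half_log_div_two_pi_re_im hs0 (by linarith) him0.le
  set L : ℂ := Complex.log (s / (2 * Real.pi)) / 2 with hLdef
  have hlogT : Real.log (2 * Real.pi) = Real.log T - ℓ := by
    rw [hℓdef, ell, Real.log_div hT0.ne' (by positivity)]; ring
  have hlog_lo : -(27 / 100) ≤ Real.log ‖s‖ - Real.log T := by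
    have h1 : Real.log (79 / 100 * T) ≤ Real.log ‖s‖ := Real.log_le_log (by positivity) hns_lo
    rw [Real.log_mul (by norm_num) hT0.ne'] at h1
    have h2 : -(27 / 100) ≤ Real.log (79 / 100 : ℝ) := by
      have := Real.log_le_sub_one_of_pos (show (0:ℝ) < 100 / 79 by norm_num)
      rw [show (100 / 79 : ℝ) = (79 / 100)⁻¹ by norm_num, Real.log_inv] at this
      linarith
    linarith
  have hlog_hi : Real.log ‖s‖ - Real.log T ≤ 78 / 100 := by
    have h1 : Real.log ‖s‖ ≤ Real.log (89 / 50 * T) :=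
      Real.log_le_log (by linarith) hns_hi
    rw [Real.log_mul (by norm_num) hT0.ne'] at h1
    have h2 : Real.log (89 / 50 : ℝ) ≤ 78 / 100 := by
      have := Real.log_le_sub_one_of_pos (show (0:ℝ) < 89 / 50 by norm_num)
      linarith
    linarith
  have hLℓ : ‖L - (ℓ / 2 : ℝ)‖ ≤ 39 / 100 + π / 4 := by
    have hre' : (L - (ℓ / 2 : ℝ)).re = (Real.log ‖s‖ - Real.log T) / 2 := by
      rw [Complex.sub_re, Complex.ofReal_re, hLre, hlogT]; ring
    have him' : (L - (ℓ / 2 : ℝ)).im = L.im := by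
      rw [Complex.sub_im, Complex.ofReal_im, sub_zero]
    have habs_re : |(L - (ℓ / 2 : ℝ)).re| ≤ 39 / 100 := by
      rw [hre', abs_le]; constructor <;> linarith
    have habs_im : |(L - (ℓ / 2 : ℝ)).im| ≤ π / 4 := by
      rw [him', abs_le]; constructor <;> linarith [Real.pi_pos]
    calc ‖L - (ℓ / 2 : ℝ)‖ ≤ |(L - (ℓ / 2 : ℝ)).re| + |(L - (ℓ / 2 : ℝ)).im| :=
          Complex.norm_le_abs_re_add_abs_im _
      _ ≤ 39 / 100 + π / 4 := add_le_add habs_re habs_im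
  -- `1/u`
  have hinvu : ‖1 / u‖ ≤ 2 / 157 := by
    rw [norm_div, norm_one]
    exact (div_le_div_iff₀ (by linarith) (by norm_num)).2 (by linarith)
  -- `(n+1)/(u+c)`: `n + 1 = hℓ/2 ≤ 10ℓ ≤ T/6`
  have h60 := sixty_mul_ell_le hT hℓ
  have hn1 : (n : ℝ) + 1 ≤ T / 6 := by nlinarith
  have hQ : ‖((n : ℂ) + 1) / (u + c)‖ ≤ 1 / 10 := by
    rw [norm_div, show ((n : ℂ) + 1) = (((n : ℝ) + 1 : ℝ) : ℂ) by push_cast; ring,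
      Complex.norm_real, Real.norm_eq_abs, abs_of_pos (by positivity)]
    rw [div_le_div_iff₀ (by linarith) (by norm_num)]
    nlinarith
  -- assemble: `D − ℓ/2 = E + (L − ℓ/2) + 1/u − (n+1)/(u+c)`
  have hsplit : saddleDen n c u - (ℓ / 2 : ℝ) =
      (lamPrime s - L) + (L - (ℓ / 2 : ℝ)) + 1 / u - ((n : ℂ) + 1) / (u + c) := by
    rw [saddleDen, hs]; ring
  have hπ : π / 4 ≤ 8 / 10 := by linarith [Real.pi_lt_d2]
  calc ‖saddleDen n c u - (ℓ / 2 : ℝ)‖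
      = ‖(lamPrime s - L) + (L - (ℓ / 2 : ℝ)) + 1 / u - ((n : ℂ) + 1) / (u + c)‖ := by
        rw [hsplit]
    _ ≤ ‖lamPrime s - L‖ + ‖L - (ℓ / 2 : ℝ)‖ + ‖1 / u‖ + ‖((n : ℂ) + 1) / (u + c)‖ := by
        have h1 := norm_sub_le ((lamPrime s - L) + (L - (ℓ / 2 : ℝ)) + 1 / u)
          (((n : ℂ) + 1) / (u + c))
        have h2 := norm_add_le ((lamPrime s - L) + (L - (ℓ / 2 : ℝ))) (1 / u)
        have h3 := norm_add_le (lamPrime s - L) (L - (ℓ / 2 : ℝ))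
        linarith
    _ ≤ 2 / 25 + (39 / 100 + π / 4) + 2 / 157 + 1 / 10 := by
        gcongr
    _ ≤ 7 / 5 := by linarith

/-- **Sharp location of the model saddle (regime R2):** under the S3 regime (`|x| ≤ ½`,
`T ≥ 100`, `ℓ_T ≥ 20`, `n ≥ 100`, `½ ≤ h ≤ (7/20)T`) with BOUNDED band radius `h = h(n,T) ≤ 20`,
a zero `u*` of `S_{n,c}` in the disc `‖u* − (c+h)‖ ≤ (3/5)h` satisfies
**`‖u* − (c + h)‖ ≤ (2 + (16/5) h)/ℓ_T`** (`u* − c = n/D`, `‖D − ℓ/2‖ ≤ 7/5`, `|D| ≥ (9/20)ℓ`,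
`2n/ℓ = h − 2/ℓ`). RH-FREE. [folklore] -/
theorem norm_arcSaddle_sub_center_sub_radius_le (hx : |x| ≤ 1 / 2) (hT : 100 ≤ T)
    (hℓ : 20 ≤ ell T) (hn : 100 ≤ n) (hh : 1 / 2 ≤ bandRadius n T)
    (hhT : bandRadius n T ≤ 7 / 20 * T) (hH : bandRadius n T ≤ 20)
    (hu : ‖u - ((x : ℂ) + (T : ℂ) * I + bandRadius n T)‖ ≤ 3 / 5 * bandRadius n T)
    (hS : arcSaddleFn n ((x : ℂ) + (T : ℂ) * I) u = 0) :
    ‖u - ((x : ℂ) + (T : ℂ) * I + bandRadius n T)‖ ≤ (2 + 16 / 5 * bandRadius n T) / ell T := by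
  set h := bandRadius n T with hhdef
  set ℓ := ell T with hℓdef
  set c : ℂ := (x : ℂ) + (T : ℂ) * I with hc
  have hℓ0 : 0 < ℓ := by linarith
  have hh0 : 0 < h := by linarith
  have hhℓ : h * ℓ = 2 * ((n : ℝ) + 1) := bandRadius_mul_ell hℓ
  have heq := sub_eq_div_saddleDen_of_arcSaddleFn_eq_zero hx hT hℓ hn hh hhT hu hS
  obtain ⟨hR_lo, -, -, -⟩ := saddleDen_re_im_bounds hx hT hℓ hh hhT hu
  have hDℓ := norm_saddleDen_sub_half_ell_le hx hT hℓ hh hhT hH hu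
  set D := saddleDen n c u with hD
  have hDnorm : 9 / 20 * ℓ ≤ ‖D‖ := by
    have := Complex.abs_re_le_norm D
    rw [abs_of_pos (by linarith)] at this
    linarith
  have hDpos : 0 < ‖D‖ := by linarith
  have hD0 : D ≠ 0 := norm_pos_iff.1 hDpos
  have hℓc : ((ℓ / 2 : ℝ) : ℂ) ≠ 0 := by
    rw [Complex.ofReal_ne_zero]; positivity
  -- `u − (c + h) = (n/D − 2n/ℓ) − 2/ℓ` with `2n/ℓ = h − 2/ℓ`
  have hn_ℓ : (2 * (n : ℝ) / ℓ : ℝ) = h - 2 / ℓ := by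
    field_simp; linarith
  have hkey : u - (c + (h : ℂ)) =
      ((n : ℂ) / D - (n : ℂ) / ((ℓ / 2 : ℝ) : ℂ)) - ((2 / ℓ : ℝ) : ℂ) := by
    have e1 : u - (c + (h : ℂ)) = (u - c) - (h : ℂ) := by ring
    have e2 : (n : ℂ) / ((ℓ / 2 : ℝ) : ℂ) = ((2 * (n : ℝ) / ℓ : ℝ) : ℂ) := by
      push_cast; field_simp
    rw [e1, heq, e2, hn_ℓ]; push_cast; ring
  -- `‖n/D − n/(ℓ/2)‖ = n‖ℓ/2 − D‖/(‖D‖·ℓ/2) ≤ n (7/5)/((9/20)ℓ · ℓ/2)`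
  have hfrac : ‖(n : ℂ) / D - (n : ℂ) / ((ℓ / 2 : ℝ) : ℂ)‖ ≤ 16 / 5 * h / ℓ := by
    have e : (n : ℂ) / D - (n : ℂ) / ((ℓ / 2 : ℝ) : ℂ) =
        (n : ℂ) * (((ℓ / 2 : ℝ) : ℂ) - D) / (D * ((ℓ / 2 : ℝ) : ℂ)) := by
      field_simp
    rw [e, norm_div, norm_mul, norm_mul, Complex.norm_natCast, Complex.norm_real, Real.norm_eq_abs,
      abs_of_pos (by positivity : (0:ℝ) < ℓ / 2), norm_sub_rev]
    rw [div_le_div_iff₀ (by positivity) hℓ0]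
    -- `n ‖D − ℓ/2‖ ℓ ≤ (16/5) h (‖D‖ ℓ/2)`
    have hn' : (n : ℝ) ≤ h * ℓ / 2 := by
      have : (n : ℝ) ≤ (n : ℝ) + 1 := by linarith
      nlinarith
    have h1 : (n : ℝ) * ‖D - ((ℓ / 2 : ℝ) : ℂ)‖ * ℓ ≤ (h * ℓ / 2) * (7 / 5) * ℓ := by
      have := mul_le_mul hn' hDℓ (norm_nonneg _) (by positivity)
      exact mul_le_mul_of_nonneg_right this hℓ0.le
    have h2 : (h * ℓ / 2) * (7 / 5) * ℓ ≤ 16 / 5 * h * (‖D‖ * (ℓ / 2)) := by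
      -- `(7/10) h ℓ² ≤ (8/5) h ‖D‖ ℓ` ⇐ `(7/10) ℓ ≤ (8/5)(9/20) ℓ = (18/25) ℓ`
      have : (7 / 10 : ℝ) * ℓ ≤ 8 / 5 * ‖D‖ := by linarith
      nlinarith
    linarith
  have htwo : ‖((2 / ℓ : ℝ) : ℂ)‖ = 2 / ℓ := by
    rw [Complex.norm_real, Real.norm_eq_abs, abs_of_pos (by positivity)]
  calc ‖u - (c + (h : ℂ))‖
      = ‖((n : ℂ) / D - (n : ℂ) / ((ℓ / 2 : ℝ) : ℂ)) - ((2 / ℓ : ℝ) : ℂ)‖ := by rw [hkey]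
    _ ≤ ‖(n : ℂ) / D - (n : ℂ) / ((ℓ / 2 : ℝ) : ℂ)‖ + ‖((2 / ℓ : ℝ) : ℂ)‖ := norm_sub_le _ _
    _ ≤ 16 / 5 * h / ℓ + 2 / ℓ := by rw [htwo]; gcongr
    _ = (2 + 16 / 5 * h) / ℓ := by ring

/-- **Sharp polar data of the saddle (regime R2):** with `ε := (2 + (16/5) h)/ℓ_T`:
`h − ε ≤ Re(u* − c)`, `|Im(u* − c)| ≤ ε`, `h − ε ≤ ‖u* − c‖ ≤ h + ε`. Consequently the own window
abscissa is `Re(½ + u*) ≥ ½ + x + h − ε`, the saddle angle satisfies `|sin φ₀| ≤ ε/(h − ε)`, and the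
kernel ratio `(r*/h)^{n+1} ≤ exp((n+1)ε/h) = exp((ℓ_T/2)ε) = e^{1 + 8h/5}` is a constant.
RH-FREE. [folklore] -/
theorem arcSaddle_sharp_polar (hx : |x| ≤ 1 / 2) (hT : 100 ≤ T)
    (hℓ : 20 ≤ ell T) (hn : 100 ≤ n) (hh : 1 / 2 ≤ bandRadius n T)
    (hhT : bandRadius n T ≤ 7 / 20 * T) (hH : bandRadius n T ≤ 20)
    (hu : ‖u - ((x : ℂ) + (T : ℂ) * I + bandRadius n T)‖ ≤ 3 / 5 * bandRadius n T)
    (hS : arcSaddleFn n ((x : ℂ) + (T : ℂ) * I) u = 0) :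
    bandRadius n T - (2 + 16 / 5 * bandRadius n T) / ell T ≤ (u - ((x : ℂ) + (T : ℂ) * I)).re ∧
    |(u - ((x : ℂ) + (T : ℂ) * I)).im| ≤ (2 + 16 / 5 * bandRadius n T) / ell T ∧
    bandRadius n T - (2 + 16 / 5 * bandRadius n T) / ell T ≤ ‖u - ((x : ℂ) + (T : ℂ) * I)‖ ∧
    ‖u - ((x : ℂ) + (T : ℂ) * I)‖ ≤ bandRadius n T + (2 + 16 / 5 * bandRadius n T) / ell T := by
  set h := bandRadius n T with hhdef
  set c : ℂ := (x : ℂ) + (T : ℂ) * I with hc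
  set ε := (2 + 16 / 5 * bandRadius n T) / ell T with hε
  have hmain : ‖u - (c + (h : ℂ))‖ ≤ ε :=
    norm_arcSaddle_sub_center_sub_radius_le hx hT hℓ hn hh hhT hH hu hS
  have e : u - (c + (h : ℂ)) = (u - c) - (h : ℂ) := by ring
  rw [e] at hmain
  have hre : |((u - c) - (h : ℂ)).re| ≤ ε := (Complex.abs_re_le_norm _).trans hmain
  have him : |((u - c) - (h : ℂ)).im| ≤ ε := (Complex.abs_im_le_norm _).trans hmain
  rw [Complex.sub_re, Complex.ofReal_re] at hre
  rw [Complex.sub_im, Complex.ofReal_im, sub_zero] at him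
  have hre' := abs_le.1 hre
  have hnorm_h : ‖(h : ℂ)‖ = h := by
    rw [Complex.norm_real, Real.norm_eq_abs, abs_of_pos (by linarith)]
  refine ⟨by linarith, him, ?_, ?_⟩
  · have := norm_sub_norm_le (h : ℂ) (u - c)
    rw [norm_sub_rev] at hmain
    linarith
  · have := norm_sub_norm_le (u - c) (h : ℂ)
    linarith

end Summit.RiemannHypothesis.RiemannHypothesis.Theorems.JensenPolynomials.LogBandArc

end
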